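import Summits.CriticalPhenomena.PercolationContinuityZ3.Theorems.Transplant.SkelPhiRootFrameRead
import Summits.CriticalPhenomena.PercolationContinuityZ3.Theorems.Transplant.SkelPhiCorridorKGYRegions
import Summits.CriticalPhenomena.PercolationContinuityZ3.Theorems.Transplant.SkelPhiCorridorKGBoxes
import HarnessLib

/-!
# N2 (frames-only node `SamePDropOfSkeletonFrm₁`, OPEN), (R) column, (R-38): **THE y′-CORRIDOR'S TWO-DIMENSIONAL SEED CLEARANCE FROM NUMERIC ROWS** —
# `Skelφ.clear_of_kgCorrSchedY_rows` (the row `hclear₃` of `NegB.rootLegAt_frmQ3D_snd` p356852, assembled)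

Region `k` of `kgCorrSchedY …` read through `runX φ c n h 1` at a landing vertex `c` with exact offset `(X, Y) := φ c − φ t`: LOW run regions `k ≤ k₀`
clear the seed ALONG (p5-g16's `kgCorrSchedY_region_run_box`: `y 0 ≥ k·v − (n+v)⁺ − W − (k+1)R′ − n`, then `lt_rootFrame_zero_of_runX`), HIGH run
regions `k₀ < k ≤ N` and both parking phases clear it ACROSS (rows-lower bounds of `…_run_box/_park₁_box/_park₂_box`, the uniform along extent
`|y 0| ≤ kgZY₀` of `mem_kgCorrSchedY_prism_box`, then `lt_rootFrame_one_of_runX`).  Hypotheses = the cutoff `k₀` and four families of NUMERIC rows in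
the closed forms of those lemmas (stmt-g21's tuple discharges them).  Cell-free.
builds on p205010 (kernel theorem, internal audit signed; external expert review pending) — nothing in this file uses p205010; nothing here is a claim
about the open node `SamePDropOfSkeletonFrm₁`.
Lane `prim-bschramm`, seat `prim-bschramm-p3` (gen 16; N2 design owner, (R) column owner); helper file (`--supports stmt-CriticalPhenomena-4575 --as helper`).
[cite: KozmaNitzan2024, §4 Lemma 11 (p. 22), Lemma 12 (pp. 23–25)] [cite: MartineauTassion2017, §3.2]
-/

noncomputable section

namespace Summit.CriticalPhenomena.PercolationContinuityZ3.Theorems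

namespace Transplant

namespace Skelφ

open Literature.Probability.Percolation Literature.Probability.LatticeModels SimpleGraph
open ChainPlanar ChainPara

variable {V : Type} {φ : V → Site 2}

variable {n ℓ : ℕ} {h v : ℤ} {R' ρ q W N m₁ Wm₂ Wp₂ m₂ : ℕ} (hn : 1 ≤ n) (hv : |v| ≤ n) (hlay : (n + h.natAbs : ℕ) ≤ (n : ℤ) * ℓ + 1)
  (hP₁ : ParkOK (kgPark₁Y n ℓ h v R' ρ q W N m₁)) (hP₂ : ParkOK (kgPark₂Y n ℓ h v R' ρ q W N m₁ Wm₂ Wp₂ m₂))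
  (hsplit : (Wm₂ : ℤ) + Wp₂ = (kgPark₁Y n ℓ h v R' ρ q W N m₁).aHi (m₁ + 1) - ParkPrm.aLo (kgPark₁Y n ℓ h v R' ρ q W N m₁) (m₁ + 1))

include hn hv hlay hP₁ hP₂ hsplit in
/-- **THE y′-CORRIDOR CLEARS THE SEED, FROM NUMERIC ROWS** (see the module docstring): for every region `k ≤ Sc.N` of `kgCorrSchedY …` and every
vertex `w` read inside it by `runX φ c n h 1`, `Rs < rootFrame φ t 1 w 0 ∨ Rs < rootFrame φ t 1 w 1`. [cite: KozmaNitzan2024, §4 Lemma 11 (p. 22)] -/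
theorem clear_of_kgCorrSchedY_rows (t c : V) {X Y Rs : ℤ} (hX : φ c 0 - φ t 0 = X) (hY : φ c 1 - φ t 1 = Y) (k₀ : ℕ)
    -- along rows for the low run regions
    (hxrow : ∀ k ≤ k₀, Rs < ((k : ℤ) * v - (((n + v).toNat + W : ℕ) : ℤ) - ((k : ℤ) + 1) * R' - n) + X)
    -- across rows for the high run regions and the two parking phases (uniform along extent `kgZY₀`)
    (hBrun : ∀ k, k₀ < k → k ≤ N → (n : ℤ) * (Rs - Y) + |h| * kgZY₀ n v R' ρ W N m₁ Wm₂ Wp₂ m₂ <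
      ((k : ℤ) * (((n : ℤ) * ℓ - (shearUnit n h : ℕ) + 1) / (shearUnit n h : ℕ)) - q - ((k : ℤ) + 1) * R' - ((3 * (n * ℓ) / shearUnit n h + 1 : ℕ) : ℤ)) *
        (shearUnit n h : ℤ))
    (hBp₁ : ∀ j ≤ m₁, (n : ℤ) * (Rs - Y) + |h| * kgZY₀ n v R' ρ W N m₁ Wm₂ Wp₂ m₂ <
      (((N : ℤ) + 1) * (((n : ℤ) * ℓ - (shearUnit n h : ℕ) + 1) / (shearUnit n h : ℕ)) - ((q : ℤ) + (N + 1) * R') - (j : ℤ) * (R' + ρ) - R' -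
        ((3 * (n * ℓ) / shearUnit n h + 1 : ℕ) : ℤ)) * (shearUnit n h : ℤ))
    (hBp₂ : (n : ℤ) * (Rs - Y) + |h| * kgZY₀ n v R' ρ W N m₁ Wm₂ Wp₂ m₂ <
      (((N : ℤ) + 1) * (((n : ℤ) * ℓ - (shearUnit n h : ℕ) + 1) / (shearUnit n h : ℕ)) - ((q : ℤ) + (N + 1) * R') - ((m₁ : ℤ) + 1) * (R' + ρ) -
        ((n : ℤ) * ℓ / (shearUnit n h : ℕ) + 1) - R' - ((3 * (n * ℓ) / shearUnit n h + 1 : ℕ) : ℤ)) * (shearUnit n h : ℤ)) :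
    ∀ k ≤ (kgCorrSchedY hn hv hlay hP₁ hP₂ hsplit).N, ∀ w : V, runX φ c n h 1 w ∈ (kgCorrSchedY hn hv hlay hP₁ hP₂ hsplit).region k →
      Rs < rootFrame φ t 1 w 0 ∨ Rs < rootFrame φ t 1 w 1 := by
  intro k hk w hw
  have hSN := (kgCorrSchedY_params hn hv hlay hP₁ hP₂ hsplit).1
  -- the uniform along extent of the prism
  have hyb := mem_kgCorrSchedY_prism_box hn hv hlay hP₁ hP₂ hsplit ((kgCorrSchedY hn hv hlay hP₁ hP₂ hsplit).sub_prism k hk hw)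
  have hZ : |runX φ c n h 1 w 0| ≤ kgZY₀ n v R' ρ W N m₁ Wm₂ Wp₂ m₂ := abs_le.2 ⟨hyb.1, hyb.2.1⟩
  by_cases hkN : k ≤ N
  · -- run phase: along for the low regions, across above
    obtain ⟨hr1, -, hx1, -⟩ := kgCorrSchedY_region_run_box hn hv hlay hP₁ hP₂ hsplit hkN hw
    by_cases hk0 : k ≤ k₀
    · exact Or.inl (lt_rootFrame_zero_of_runX t c n h hX hx1 (hxrow k hk0))
    · exact Or.inr (lt_rootFrame_one_of_runX t c hn h hY hr1 hZ (hBrun k (by omega) hkN))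
  · by_cases hk1 : k ≤ N + 1 + m₁
    · -- first parking phase
      obtain ⟨j, rfl⟩ : ∃ j, k = N + 1 + j := ⟨k - (N + 1), by omega⟩
      have hj : j ≤ m₁ := by omega
      obtain ⟨hr1, -, -, -⟩ := kgCorrSchedY_region_park₁_box hn hv hlay hP₁ hP₂ hsplit hj hw
      exact Or.inr (lt_rootFrame_one_of_runX t c hn h hY hr1 hZ (hBp₁ j hj))
    · -- second parking phase
      obtain ⟨j, rfl⟩ : ∃ j, k = N + 1 + m₁ + 1 + j := ⟨k - (N + 1 + m₁ + 1), by omega⟩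
      obtain ⟨hr1, -, -, -⟩ := kgCorrSchedY_region_park₂_box hn hv hlay hP₁ hP₂ hsplit j hw
      exact Or.inr (lt_rootFrame_one_of_runX t c hn h hY hr1 hZ hBp₂)

end Skelφ

end Transplant

end Summit.CriticalPhenomena.PercolationContinuityZ3.Theorems

end
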